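import Literature.NumberTheory.Weil1964.UnitaryArchSingularTopFormFamilyQuotient           -- ★ `isQuotientOf_archSingularTopFormFamily` (the top-form family is the Weil quotient by `centralizerTopFormHaar` on framed classes)
import Literature.NumberTheory.Weil1964.UnitaryArchSingularCentralizerTopFormHaarCongr      -- ★ (b0) `map_archCongr_centralizerTopFormHaar`, `exists_isSingularArchFrame_archCongr`
import Literature.NumberTheory.Weil1964.UnitaryArchSingularCentralizerTopFormHaarCoherence  -- ★ (hcoh) `map_subgroupCongrHomeomorph_conj_centralizerTopFormHaar`, `exists_isSingularArchFrame_conj`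
import Literature.NumberTheory.Automorphic.OrbitalMeasureFamilyOfTorusDatum                -- ★ `IsQuotientOf.transport_of_pullback`, `IsQuotientOf.of_imp_of_eq`, `map_subgroupCongrHomeomorph_congr`
import Literature.NumberTheory.Rogawski1990.TamagawaSingularKappaTransportQ                -- ★ `stableOrbitalIntegralRel_eq_of_isQuotientOf` (two Weil families of the same data have equal stable sums)
import Literature.NumberTheory.Rogawski1990.ArchInnerTransferCongruence                    -- ★ `archStableOrbitalIntegral_transport_archCongr` (the unsigned stable sum under a congruence)
import Literature.NumberTheory.Rogawski1990.ArchSingularStableTransportWallTorus             -- ★ `archStableOrbitalIntegral_eq_of_isStablyConj`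
import Literature.NumberTheory.Automorphic.ArchCongruenceOrbitalTransport                  -- ★ `formCongr_map_mixedEmbedding_archFormOf_eq`
import HarnessLib

/-!
# `K2E4ArchSingularTopFormTransport` — the unsigned TOP-FORM stable sum is transported along a rational congruence and a stable conjugacy (the `hTr` input of ★ p855083)
# (Rogawski 1990 §1.7 p. 6 «compatible measures», §3.8 Prop. 3.8.1 (a), §4.1 (4.1.1); Deitmar–Echterhoff Thm. 1.5.3)

Track B ∕ K2-LIT, crux h413 = `stmt-HodgeConjecture-24833`; prover seat `hodgecm-mathlib-K2E4-p09` (g0); lane `--supports stmt-HodgeConjecture-24833 --as helper`.  THEOREMS ONLY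
(no `def`, no instance, no notation, no `sorry`).  **`topFormTransport`** has EXACTLY the type of the hypothesis `hTr` of ★ `K2E4ExplicitArchSingularTransferOfPackages.explicitArchSingularTransfer_of_packages`:
for a rational congruence `Φ : U(diagonal α)_∞ ≃ₜ* U(H′)_∞` (`g ↦ (P₀⊗1) g (P₀⊗1)⁻¹`, `σ(P₀)ᵀ H′ P₀ = diagonal α`), a Haar `νGi` with `ν₂ = Φ⁻¹_*νGi`, a test function `a`, and points `x ∈ U(H′)_∞`,
`y ∈ U(diagonal α)_∞` with `Φ⁻¹ x ∼_st y` and EVERY stable conjugate of `x` framed (★ `IsSingularArchFrame`), the unsigned stable sums agree: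
`Φ^{st}_∞(x, a; TF(νGi)) = Φ^{st}_∞(y, a ∘ Φ; TF(ν₂))` (`TF` = ★ `archSingularTopFormFamily`).
PROOF.  (A) stable conjugacy on the diagonal side (★ `archStableOrbitalIntegral_eq_of_isStablyConj`); (B) the unsigned sum under the congruence with the TRANSPORTED family
`Φ_* TF(ν₂)` (★ `archStableOrbitalIntegral_transport_archCongr`); (C) `Φ_* TF(ν₂)` and `TF(νGi)` are BOTH the Weil quotient of `νGi` by `centralizerTopFormHaar` on the framed classes —
`TF(νGi)` by ★ `isQuotientOf_archSingularTopFormFamily`, `Φ_* TF(ν₂)` by ★ `IsQuotientOf.transport_of_pullback` fed with the conjugation coherence of the top-form centraliser datum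
(★ (hcoh)), conjugation stability of frames, and the identification of the pulled-back datum with `centralizerTopFormHaar` on `U(diagonal α)_∞` (★ (b0) along `Φ⁻¹`, ★
`map_subgroupCongrHomeomorph_congr`) — so their stable sums over the (framed) stable class of `x` agree (★ `stableOrbitalIntegralRel_eq_of_isQuotientOf`).
HONEST LABEL: HC_CM is proved only modulo the 7 printed citations (2 remaining named inputs: hLiu418 = `stmt-HodgeConjecture-24832`, h413 = `stmt-HodgeConjecture-24833`) until rung 0
closes; this file is measure bookkeeping and pays nothing by itself.

## References
* [Rogawski1990] J. D. Rogawski, *Automorphic Representations of Unitary Groups in Three Variables*, Ann. of Math. Stud. 123 (1990), §1.7 p. 6; §3.8 Prop. 3.8.1 (a) p. 27; §4.1 (4.1.1) p. 39;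
  §14.4 p. 237.
* [DeitmarEchterhoff2014] A. Deitmar, S. Echterhoff, *Principles of Harmonic Analysis*, 2nd ed. (2014), Thm. 1.5.3.
* [Gelbart1975] S. Gelbart, *Automorphic Forms on Adele Groups* (1975), §10 pp. 154–155.
-/

set_option autoImplicit false
-- the mandated namespace repeats the single-problem summit's segment (`HodgeConjecture.HodgeConjecture`)
set_option linter.dupNamespace false

noncomputable section

open MeasureTheory Measure NumberField NumberField.InfinitePlace NumberField.mixedEmbedding IsDedekindDomain Filter Topology Set
open Literature.MeasureTheory.Group Literature.NumberTheory.Rogawski1990 Literature.NumberTheory.Automorphic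
open Literature.NumberTheory.Weil1964.UnitaryArchTopForm
open Literature.AlgebraicGeometry.ShimuraVarieties (unitaryGroup hermForm)
open scoped Matrix MatrixGroups Classical

namespace Summit.HodgeConjecture.HodgeConjecture.Cruxes.H413.K2E4ArchSingularTopFormTransport

section Transport

variable (L : Type) [Field L] [NumberField L] [IsCMField L] (H' : Matrix (Fin 3) (Fin 3) L)
    [MeasurableSpace (UnitaryGroup.arch (↥(maximalRealSubfield L)) L (IsCMField.complexConj L) 3 H')] [BorelSpace (UnitaryGroup.arch (↥(maximalRealSubfield L)) L (IsCMField.complexConj L) 3 H')]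
    [∀ γ : UnitaryGroup.arch (↥(maximalRealSubfield L)) L (IsCMField.complexConj L) 3 H', MeasurableSpace (UnitaryGroup.arch (↥(maximalRealSubfield L)) L (IsCMField.complexConj L) 3 H' ⧸ Subgroup.centralizer ({γ} : Set (UnitaryGroup.arch (↥(maximalRealSubfield L)) L (IsCMField.complexConj L) 3 H')))]
    [∀ γ : UnitaryGroup.arch (↥(maximalRealSubfield L)) L (IsCMField.complexConj L) 3 H', BorelSpace (UnitaryGroup.arch (↥(maximalRealSubfield L)) L (IsCMField.complexConj L) 3 H' ⧸ Subgroup.centralizer ({γ} : Set (UnitaryGroup.arch (↥(maximalRealSubfield L)) L (IsCMField.complexConj L) 3 H')))]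
    (νGi : Measure (UnitaryGroup.arch (↥(maximalRealSubfield L)) L (IsCMField.complexConj L) 3 H')) [IsFiniteMeasureOnCompacts νGi] [νGi.IsMulRightInvariant]

set_option maxHeartbeats 4000000 in
set_option linter.overlappingInstances false in  -- `[νGi.IsHaarMeasure]` sits INSIDE the ∀ (the consumer's `hTr` type, bytes frozen) next to the frame's `[IsFiniteMeasureOnCompacts νGi]`
/-- **THE TOP-FORM TRANSPORT** (the `hTr` input of ★ `explicitArchSingularTransfer_of_packages`, same type): along a rational congruence `Φ` (`g ↦ (P₀⊗1) g (P₀⊗1)⁻¹`) and a stable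
conjugacy `Φ⁻¹ x ∼_st y`, with every stable conjugate of `x` framed, `Φ^{st}_∞(x, a; TF(νGi)) = Φ^{st}_∞(y, a ∘ Φ; TF(Φ⁻¹_*νGi))`.
[cite: Rogawski1990, §1.7 p. 6; §3.8 Prop. 3.8.1 (a) p. 27; §4.1 (4.1.1) p. 39; §14.4 p. 237] [cite: DeitmarEchterhoff2014, Thm. 1.5.3] -/
theorem topFormTransport : ∀ (α : Fin 3 → L) (P₀ : GL (Fin 3) L) (_hPα : formCongr (cmConjRingHom L) P₀ H' = Matrix.diagonal α)
        [MeasurableSpace (UnitaryGroup.arch (↥(maximalRealSubfield L)) L (IsCMField.complexConj L) 3 (Matrix.diagonal α))] [BorelSpace (UnitaryGroup.arch (↥(maximalRealSubfield L)) L (IsCMField.complexConj L) 3 (Matrix.diagonal α))]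
        [∀ γ : UnitaryGroup.arch (↥(maximalRealSubfield L)) L (IsCMField.complexConj L) 3 (Matrix.diagonal α), MeasurableSpace (UnitaryGroup.arch (↥(maximalRealSubfield L)) L (IsCMField.complexConj L) 3 (Matrix.diagonal α) ⧸ Subgroup.centralizer ({γ} : Set (UnitaryGroup.arch (↥(maximalRealSubfield L)) L (IsCMField.complexConj L) 3 (Matrix.diagonal α))))]
        [∀ γ : UnitaryGroup.arch (↥(maximalRealSubfield L)) L (IsCMField.complexConj L) 3 (Matrix.diagonal α), BorelSpace (UnitaryGroup.arch (↥(maximalRealSubfield L)) L (IsCMField.complexConj L) 3 (Matrix.diagonal α) ⧸ Subgroup.centralizer ({γ} : Set (UnitaryGroup.arch (↥(maximalRealSubfield L)) L (IsCMField.complexConj L) 3 (Matrix.diagonal α))))]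
        (Φ : UnitaryGroup.arch (↥(maximalRealSubfield L)) L (IsCMField.complexConj L) 3 (Matrix.diagonal α) ≃ₜ* UnitaryGroup.arch (↥(maximalRealSubfield L)) L (IsCMField.complexConj L) 3 H')
        (_hΦ : ∀ g, ((Φ g : UnitaryGroup.arch (↥(maximalRealSubfield L)) L (IsCMField.complexConj L) 3 H') : GL (Fin 3) (mixedEmbedding.mixedSpace L)) =
          Matrix.GeneralLinearGroup.map (mixedEmbedding L) P₀ * (g : GL (Fin 3) (mixedEmbedding.mixedSpace L)) * (Matrix.GeneralLinearGroup.map (mixedEmbedding L) P₀)⁻¹)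
        [νGi.IsHaarMeasure] (ν₂ : Measure (UnitaryGroup.arch (↥(maximalRealSubfield L)) L (IsCMField.complexConj L) 3 (Matrix.diagonal α))) [ν₂.IsHaarMeasure] [ν₂.IsMulRightInvariant] (_hν₂ : ν₂ = νGi.map Φ.symm)
        (a : UnitaryGroup.arch (↥(maximalRealSubfield L)) L (IsCMField.complexConj L) 3 H' → ℂ) (x : UnitaryGroup.arch (↥(maximalRealSubfield L)) L (IsCMField.complexConj L) 3 H') (y : UnitaryGroup.arch (↥(maximalRealSubfield L)) L (IsCMField.complexConj L) 3 (Matrix.diagonal α)),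
        IsStablyConj (UnitaryGroup.conjMixed (↥(maximalRealSubfield L)) L (IsCMField.complexConj L)) (UnitaryGroup.archFormOf L 3 (Matrix.diagonal α)) (Φ.symm x) y →
        (∀ x' : UnitaryGroup.arch (↥(maximalRealSubfield L)) L (IsCMField.complexConj L) 3 H', IsStablyConj (UnitaryGroup.conjMixed (↥(maximalRealSubfield L)) L (IsCMField.complexConj L)) (UnitaryGroup.archFormOf L 3 H') x x' →
          ∃ (a₀ b₀ : L) (T₀ : GL (Fin 3) (mixedEmbedding.mixedSpace L)) (Ha : Matrix (Fin 2) (Fin 2) L) (Hb : Matrix (Fin 1) (Fin 1) L),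
            IsSingularArchFrame L H' x' a₀ b₀ T₀ Ha Hb) →
        archStableOrbitalIntegral L 3 H' (archSingularTopFormFamily L H' νGi) a x =
          archStableOrbitalIntegral L 3 (Matrix.diagonal α) (archSingularTopFormFamily L (Matrix.diagonal α) ν₂) (a ∘ Φ) y := by
  intro α P₀ hPα iM iB iQ iQB Φ hΦ iHaar ν₂ iν₂ iν₂' hν₂ a x y hst hframes
  have hT₃ := UnitaryGroup.formCongr_map_mixedEmbedding_archFormOf_eq L hPα
  subst hν₂
  -- the inverse congruence `Ψ : U(H′)_∞ ≃ₜ* U(diagonal α)_∞`, `g ↦ (P₀⊗1)⁻¹ g (P₀⊗1)` (= `Φ⁻¹` pointwise)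
  have hS : formCongr (UnitaryGroup.conjMixed (↥(maximalRealSubfield L)) L (IsCMField.complexConj L)) (Matrix.GeneralLinearGroup.map (mixedEmbedding L) P₀)⁻¹ (UnitaryGroup.archFormOf L 3 (Matrix.diagonal α)) =
      UnitaryGroup.archFormOf L 3 H' := by
    rw [← hT₃, formCongr_inv_formCongr]
  set ΨS : UnitaryGroup.arch (↥(maximalRealSubfield L)) L (IsCMField.complexConj L) 3 H' ≃ₜ* UnitaryGroup.arch (↥(maximalRealSubfield L)) L (IsCMField.complexConj L) 3 (Matrix.diagonal α) :=
    unitaryGroupOfFormCongrOfEq (UnitaryGroup.conjMixed (↥(maximalRealSubfield L)) L (IsCMField.complexConj L)) (Matrix.GeneralLinearGroup.map (mixedEmbedding L) P₀)⁻¹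
      (UnitaryGroup.archFormOf L 3 (Matrix.diagonal α)) (UnitaryGroup.archFormOf L 3 H') hS
  have hΦsymm : ∀ g, ((Φ.symm g : UnitaryGroup.arch (↥(maximalRealSubfield L)) L (IsCMField.complexConj L) 3 (Matrix.diagonal α)) : GL (Fin 3) (mixedEmbedding.mixedSpace L)) =
      (Matrix.GeneralLinearGroup.map (mixedEmbedding L) P₀)⁻¹ * (g : GL (Fin 3) (mixedEmbedding.mixedSpace L)) * ((Matrix.GeneralLinearGroup.map (mixedEmbedding L) P₀)⁻¹)⁻¹ := by
    intro g
    have h := hΦ (Φ.symm g)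
    rw [ContinuousMulEquiv.apply_symm_apply] at h
    rw [inv_inv, h]
    simp only [← mul_assoc, inv_mul_cancel, one_mul, inv_mul_cancel_right]
  have hΨΦ : ∀ g, ΨS g = Φ.symm g := fun g => Subtype.ext (by rw [hΦsymm g]; rfl)
  /- (A) stable conjugacy on the diagonal carrier -/
  rw [← archStableOrbitalIntegral_eq_of_isStablyConj L 3 (Matrix.diagonal α) (archSingularTopFormFamily L (Matrix.diagonal α) (νGi.map Φ.symm)) (a ∘ Φ) hst]
  /- (B) the congruence, with the transported family -/
  have hB := archStableOrbitalIntegral_transport_archCongr L (Matrix.GeneralLinearGroup.map (mixedEmbedding L) P₀) Φ hΦ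
    (archSingularTopFormFamily L (Matrix.diagonal α) (νGi.map Φ.symm)) (a ∘ Φ) (Φ.symm x)
  have hcomp : ((a ∘ Φ) ∘ Φ.symm) = a := by
    funext g
    simp only [Function.comp_apply, ContinuousMulEquiv.apply_symm_apply]
  rw [hcomp, ContinuousMulEquiv.apply_symm_apply] at hB
  rw [← hB]
  /- (C) both families are the Weil quotient of `νGi` by `centralizerTopFormHaar` on the framed classes -/
  refine stableOrbitalIntegralRel_eq_of_isQuotientOf (isQuotientOf_archSingularTopFormFamily L H' νGi) ?_ _ a x (fun x' hx' => hframes x' hx')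
  -- `νGi = Φ_* (Φ⁻¹_* νGi)`
  have hν : νGi = Measure.map Φ.toMulEquiv (νGi.map Φ.symm) := by
    have hm₁ : Measurable (⇑Φ.toMulEquiv) := Φ.continuous.measurable
    have hm₂ : Measurable (⇑Φ.symm) := Φ.symm.continuous.measurable
    rw [Measure.map_map hm₁ hm₂]
    have : (⇑Φ.toMulEquiv ∘ ⇑Φ.symm) = id := funext fun g => Φ.apply_symm_apply g
    rw [this, Measure.map_id]
  -- frames are conjugation-stable; `centralizerTopFormHaar` is conjugation-coherent (★ (hcoh))
  have hP : ∀ (a₁ q : UnitaryGroup.arch (↥(maximalRealSubfield L)) L (IsCMField.complexConj L) 3 H'),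
      (∃ (a₀ b₀ : L) (T₀ : GL (Fin 3) (mixedEmbedding.mixedSpace L)) (Ha : Matrix (Fin 2) (Fin 2) L) (Hb : Matrix (Fin 1) (Fin 1) L), IsSingularArchFrame L H' a₁ a₀ b₀ T₀ Ha Hb) →
      (∃ (a₀ b₀ : L) (T₀ : GL (Fin 3) (mixedEmbedding.mixedSpace L)) (Ha : Matrix (Fin 2) (Fin 2) L) (Hb : Matrix (Fin 1) (Fin 1) L), IsSingularArchFrame L H' (q * a₁ * q⁻¹) a₀ b₀ T₀ Ha Hb) :=
    fun a₁ q h => exists_isSingularArchFrame_conj a₁ q h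
  -- frames pass along `Ψ` (★ `exists_isSingularArchFrame_archCongr`), read at a free target point
  have hfr : ∀ (x' : UnitaryGroup.arch (↥(maximalRealSubfield L)) L (IsCMField.complexConj L) 3 H')
      (_ : ∃ (a₀ b₀ : L) (T₀ : GL (Fin 3) (mixedEmbedding.mixedSpace L)) (Ha : Matrix (Fin 2) (Fin 2) L) (Hb : Matrix (Fin 1) (Fin 1) L), IsSingularArchFrame L H' x' a₀ b₀ T₀ Ha Hb)
      (q : UnitaryGroup.arch (↥(maximalRealSubfield L)) L (IsCMField.complexConj L) 3 (Matrix.diagonal α)) (_ : ΨS x' = q),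
      ∃ (a₀ b₀ : L) (T₀ : GL (Fin 3) (mixedEmbedding.mixedSpace L)) (Ha : Matrix (Fin 2) (Fin 2) L) (Hb : Matrix (Fin 1) (Fin 1) L), IsSingularArchFrame L (Matrix.diagonal α) q a₀ b₀ T₀ Ha Hb := by
    intro x' hx' q hq
    subst hq
    exact exists_isSingularArchFrame_archCongr (Matrix.GeneralLinearGroup.map (mixedEmbedding L) P₀)⁻¹ hS x' hx'
  -- the pulled-back datum IS the top-form centraliser datum of `U(diagonal α)_∞` (★ (b0) along `Ψ`, read through `Φ⁻¹ = Ψ` pointwise)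
  have hkey : ∀ (x' : UnitaryGroup.arch (↥(maximalRealSubfield L)) L (IsCMField.complexConj L) 3 H')
      (_ : ∃ (a₀ b₀ : L) (T₀ : GL (Fin 3) (mixedEmbedding.mixedSpace L)) (Ha : Matrix (Fin 2) (Fin 2) L) (Hb : Matrix (Fin 1) (Fin 1) L), IsSingularArchFrame L H' x' a₀ b₀ T₀ Ha Hb)
      (q : UnitaryGroup.arch (↥(maximalRealSubfield L)) L (IsCMField.complexConj L) 3 (Matrix.diagonal α)) (hq : ΨS x' = q)
      (hmem : ∀ g, Φ.toMulEquiv.symm g ∈ Subgroup.centralizer ({q} : Set (UnitaryGroup.arch (↥(maximalRealSubfield L)) L (IsCMField.complexConj L) 3 (Matrix.diagonal α))) ↔ g ∈ Subgroup.centralizer ({x'} : Set (UnitaryGroup.arch (↥(maximalRealSubfield L)) L (IsCMField.complexConj L) 3 H')))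
      (c₁ : Continuous Φ.toMulEquiv.symm) (c₂ : Continuous Φ.toMulEquiv.symm.symm),
      (centralizerTopFormHaar L H' x').map (subgroupCongrHomeomorph Φ.toMulEquiv.symm
        (Subgroup.centralizer ({x'} : Set (UnitaryGroup.arch (↥(maximalRealSubfield L)) L (IsCMField.complexConj L) 3 H'))) (Subgroup.centralizer ({q} : Set (UnitaryGroup.arch (↥(maximalRealSubfield L)) L (IsCMField.complexConj L) 3 (Matrix.diagonal α)))) hmem c₁ c₂) =
        centralizerTopFormHaar L (Matrix.diagonal α) q := by
    intro x' hx' q hq hmem c₁ c₂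
    subst hq
    rw [map_subgroupCongrHomeomorph_congr Φ.toMulEquiv.symm ΨS.toMulEquiv (fun g => show Φ.symm g = ΨS g from (hΨΦ g).symm) _ _ hmem
      (forall_apply_mem_centralizer_singleton_iff_of_eq ΨS.toMulEquiv rfl) c₁ c₂ ΨS.continuous ΨS.symm.continuous]
    exact map_archCongr_centralizerTopFormHaar (Matrix.GeneralLinearGroup.map (mixedEmbedding L) P₀)⁻¹ hS hx'
  refine ((isQuotientOf_archSingularTopFormFamily L (Matrix.diagonal α) (νGi.map Φ.symm)).of_imp_of_eq ?_ ?_).transport_of_pullback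
    Φ.toMulEquiv Φ.continuous Φ.symm.continuous hP (νGi.map Φ.symm) νGi hν (fun γ => centralizerTopFormHaar L H' γ)
    (fun a₁ a₂ q hq ha₁ => map_subgroupCongrHomeomorph_conj_centralizerTopFormHaar q hq ha₁)
  · -- frames pass from `Φ b` to `b` (★ `exists_isSingularArchFrame_archCongr` along `Ψ`, `Ψ (Φ b) = b`)
    intro c hc
    have hb : ΨS (Φ.toMulEquiv (Quotient.out c)) = Quotient.out c := by
      show ΨS (Φ (Quotient.out c)) = Quotient.out c
      rw [hΨΦ, ContinuousMulEquiv.symm_apply_apply]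
    exact hfr _ hc _ hb
  · -- the pulled-back datum at `out c` is `centralizerTopFormHaar (out c)`
    intro c hc
    have hb : ΨS (Φ.toMulEquiv (Quotient.out c)) = Quotient.out c := by
      show ΨS (Φ (Quotient.out c)) = Quotient.out c
      rw [hΨΦ, ContinuousMulEquiv.symm_apply_apply]
    exact hkey _ hc _ hb _ _ _

end Transport

end Summit.HodgeConjecture.HodgeConjecture.Cruxes.H413.K2E4ArchSingularTopFormTransport

end
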